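import Summits.BirchSwinnertonDyer.BirchSwinnertonDyer.Theorems.ClassRecordThreeCornerAtThreeShimuraSavedOrderBoundOfImageTD
import HarnessLib

/-!
# Route `ErratumRoadFive` (K2, `p ≥ 5`), crux `EulerHalfNotRamNoInertSetAtFive` (item stmt-BirchSwinnertonDyer-19715), line `birth` v13:
# THE TWO PORT TARGETS OF THE SHIMURA-CURVE JETCHEV WALK AT ANY ODD `p ∈ S`, GENERIC IN THE TWO SINGLE-DATUM PRODUCERS
# (the identity-component input abstracted: `hSel` ∕ `hstrqT` are HYPOTHESES, so (B6) at the carriers, Gross's E′-label, or any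
# other supplier of the receptacle plugs in) — cell `bsd-stepL`, width seat `bsd-line-er5-p1-w3` g5; `--supports stmt-BirchSwinnertonDyer-19715 --as helper`

WHY THIS FILE. In lane B g10's image-keyed port targets on the TD frame (`Koly.shimuraLevelSupplyAt_of_poitouTate_ofImage_of_carrierLabels`,
`ShimuraWalk.swapSupplyAt_of_poitouTate_of_hceb_of_carrierLabels`; consumed by `savedOrderBound_of_labels_ofImage_of_carrierLabels` p621386 and
thence by 19715's SAV `EulerHalfInertUpToOne.shimuraInertSavedDisplayAtD_of_carrierLabelsB6_of_five_le` p624474) the label (B6) at the carrier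
primes enters through EXACTLY two single-datum producers: the Kummer membership `hSel` (Gross 6.2 (1), `c_M(d) ∈ Sel_𝔳` off `n`) and the
stringent membership `hstrq` (Jetchev 4.9, `loc_v c_k(d) ∈ H¹_{𝓕⁰}(K_v)` at the bad places over a carrier `q ∉ S`). THIS FILE states the two
port targets with those producers as HYPOTHESES (everything else — tam3-p1's level END, lane B g8's ∀-datum producers `hsign` ∕ `h47`,
corner-p1's image-keyed Čebotarev, the (P1) swap layer — is the landed text VERBATIM), so that the companion file
`…EulerHalfNotRamE0PrimeReceptacle` (producers from Gross's E′-label «some prime-to-`p` multiple of `y_m` lies in `E⁰`», LMS 1991 p. 245)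
feeds them without touching (B6): the re-threading asked by bsd-idea-9 g7 (HOME INBOX 2026-08-28T13:03:53Z).
* §1 `ShimuraWalk.swapSupplyAt_of_poitouTate_of_hceb_of_hSel` — PORT TARGET 1 from `hPT`, `hceb`, `LabelsAt` and a GIVEN `hSel`.
* §2 `Koly.shimuraLevelSupplyAt_of_poitouTate_ofImage_of_producers` — PORT TARGET 2 at every `q ∉ S` from `hPT`, `LabelsAt`, the four mod-`p`
  image inputs, a GIVEN `hSel` and a GIVEN per-carrier stringent producer `hstrqT`.
The (DIV) clause, the saved order bound and SAV from LAB′ follow in `…EulerHalfNotRamInertSavedOfCarrierE0Prime`.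

HONEST FRAMING: conditional theorems (inputs `hPT`, `hceb` ∕ the image inputs, the labels `LabelsAt`, the two producers); no definition, no named
fact, no `sorry`; nothing booked; no stub ∕ item closes; 19715 stays OPEN; no census label moves (T7); BSD is proved for no curve.
-- adapted from Summits/…/Theorems/ClassRecordThreeCornerAtThreeShimuraSwapSupplyOfPoitouTateGenericTD.lean (§1) and
-- Summits/…/Theorems/ClassRecordThreeCornerAtThreeShimuraPortTargetsOfImageTD.lean §1 (§2): hypotheses `hB6T` ↦ (`hSel`, `hstrqT`), nothing else.
References (locators only): [cite: Jetchev2008, Thm. 1.4, Thm. 6.3, Prop. 6.4, Prop. 4.9, Lemma 5.1] [cite: McCallumLMS1991, §5 Prop. 5.2, §4 Prop. 4.4,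
§3 Cor. 3.2] [cite: GrossLMS1991, §3 (3.2), Prop. 5.4, §6 Prop. 6.2 (1), p. 245] [cite: CasselsFrohlichANT1967, Ch. VII Prop. 1.2 (ii)].
presearch: n/a (re-keying of tree theorems). Axioms: `propext`, `Classical.choice`, `Quot.sound`.
-/

set_option autoImplicit false
set_option linter.dupNamespace false -- `Summit.BirchSwinnertonDyer.BirchSwinnertonDyer` (summit = problem), tree-wide

noncomputable section

open scoped Classical NumberField Pointwise

/-! ### §1 PORT TARGET 1 (`SwapSupplyAt`) generic in the Kummer producer -/

namespace Summit.BirchSwinnertonDyer.BirchSwinnertonDyer.Theorems.ShimuraWalk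

open WeierstrassCurve IsDedekindDomain NumberField Field Function Literature.NumberTheory.EllipticCurves
  Literature.NumberTheory.EllipticCurves.ModularForms Literature.NumberTheory.EllipticCurves.Jetchev2008
  Literature.NumberTheory.EllipticCurves.KolyvaginCocycle
  Literature.NumberTheory.EllipticCurves.Rank1Residual Literature.NumberTheory.GaloisRepresentations
  Literature.NumberTheory.GaloisCohomology Literature.NumberTheory.Automorphic
  Summit.BirchSwinnertonDyer.Rank1Residual.JET Summit.BirchSwinnertonDyer.Rank1Residual.JET.SelmerVocabulary
  Summit.BirchSwinnertonDyer.Rank1Residual.JET.Walk Summit.BirchSwinnertonDyer.Rank1Residual.JET.GlobalDuality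
  Summit.BirchSwinnertonDyer.Rank1Residual.X11b Summit.BirchSwinnertonDyer.Rank1Residual.X11b.Three
  Summit.BirchSwinnertonDyer.BirchSwinnertonDyer.Theorems
  Literature.NumberTheory.EllipticCurves.ShimuraCMFamily

set_option maxHeartbeats 800000 in
/-- **`SwapSupplyAt` at ANY odd prime `p ∈ S` from Poitou–Tate + a Gross-currency Čebotarev supply, GENERIC IN THE KUMMER PRODUCER `hSel`**
(Gross 6.2 (1) for every datum of the family at the finite places off `n`, a hypothesis) — lane B g10's
`swapSupplyAt_of_poitouTate_of_hceb_of_carrierLabels` VERBATIM with its internal (B6)-fed `hSel` turned into a binder (and the then-idle `hsp`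
dropped). CONDITIONAL on `hPT`, `hceb`, `hSel`; nothing booked. [cite: McCallumLMS1991, §5 Prop. 5.2, §4 Prop. 4.4, §3 Cor. 3.2]
[cite: GrossLMS1991, §3 (3.2), Prop. 5.4, §6 Prop. 6.2 (1)] [cite: Jetchev2008, §3.1.2, §3.4.1, Lemma 5.1] -/
theorem swapSupplyAt_of_poitouTate_of_hceb_of_hSel
    (hPT : ∀ (K : Type) [Field K] [NumberField K], poitouTate_selmerStructure_duality_conj K)
    (W : WeierstrassCurve ℚ) [W.IsElliptic] [W.IsGloballyMinimal] (N : ℕ) [NeZero N]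
    (K : Type) [Field K] [NumberField K] (S : Finset ℕ) (Dt : ModularParametrizationData W N)
    (hN : W.conductorNorm ℤ = N) {p : ℕ} [Fact p.Prime] (hp2 : p ≠ 2) (hirr : W.HasIrreducibleModPGaloisRep p)
    (hK : IsImaginaryQuadratic K) (hD : NumberField.discr K < -4)
    (hin : ∀ ℓ ∈ S, ℓ.Prime ∧ ℓ ∣ N ∧ ¬ ℓ ^ 2 ∣ N ∧
      ((Ideal.span {(ℓ : ℤ)}).primesOver (𝓞 K)).ncard = 1 ∧ ¬ (ℓ : ℤ) ∣ NumberField.discr K)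
    (hpS : p ∈ S) (ι : K →+* ℂ) (y : (W.baseChange K).toAffine.Point)
    (ys : (m : ℕ) → (W.baseChange (ringClassField K ι m)).toAffine.Point) (ε : ℤ)
    (hL : LabelsAt W N K ι y ys ε)
    -- the single-datum Kummer producer (Gross 6.2 (1)) as a HYPOTHESIS: any supplier (`…_of_labelsAt_of_tamagawa` from (B6) at the
    -- carriers, `…_of_tamagawa_of_E0Prime` from the E′-labels, …) may be plugged in
    (hSel : ∀ (M n : ℕ) (d : KolyvaginFamilyData W K ι n), 1 ≤ M → d.y = ys n → Squarefree n →
      (∀ q ∈ n.primeFactors, IsKolyvaginPrime N W K p q ∧ FrobEqFrobInfty W K (p ^ M) q) →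
      ∀ 𝔳 : HeightOneSpectrum (𝓞 K), (n : 𝓞 K) ∉ 𝔳.asIdeal →
        d.kolyvaginClass (Fact.out : p.Prime) M ∈
          selmerLocalKer (W.baseChange K) (𝔳.adicCompletion K) ((p ^ M : ℕ) : ℤ))
    (hceb : ∀ (τ : K ≃ₐ[ℚ] K), τ ≠ 1 → ∀ (j : ℕ) (e₁ : ℤ), (e₁ = 1 ∨ e₁ = -1) →
      ∀ (x y : galoisCohomology ((W.baseChange K).torsionGaloisModule ((p ^ 1 : ℕ) : ℤ)) 1),
      conjAct W τ ((p ^ 1 : ℕ) : ℤ) x = e₁ • x → conjAct W τ ((p ^ 1 : ℕ) : ℤ) y = (-e₁) • y → y ≠ 0 →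
      ∀ (b : ℕ), ∃ ℓ : ℕ, b < ℓ ∧ IsKolyvaginPrime N W K p ℓ ∧ FrobEqFrobInfty W K (p ^ (1 + j)) ℓ ∧
        ∀ v : HeightOneSpectrum (𝓞 K), (ℓ : 𝓞 K) ∈ v.asIdeal →
          addOrderOf (galoisCohomology.localization
              ((W.baseChange K).torsionGaloisModule ((p ^ 1 : ℕ) : ℤ)) (Sum.inr v) 1 x) = addOrderOf x ∧
          addOrderOf (galoisCohomology.localization
              ((W.baseChange K).torsionGaloisModule ((p ^ 1 : ℕ) : ℤ)) (Sum.inr v) 1 y) = addOrderOf y) :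
    SwapSupplyAt hK ι W N p ys := by
  subst hN
  haveI : ∀ j : ℕ, NumberField (ringClassField K ι j) := numberField_ringClassField K hK ι
  have hp : p.Prime := Fact.out
  have hD3 : NumberField.discr K ≠ -3 := by omega
  have hD4 : NumberField.discr K ≠ -4 := by omega
  -- `E(K)[p] = 0` (`E[p]` irreducible)
  have hbot : AddSubgroup.torsionBy (W.baseChange K).toAffine.Point ((p : ℕ) : ℤ) = ⊥ :=
    torsionBy_eq_bot_of_isImaginaryQuadratic_of_hasIrreducibleModPGaloisRep W K hK hp hirr
  -- `p` is unramified in `K` (`p ∈ S`), the Weil pairing; admissibility of `E(K[n])` for every datum (`E[p]` irreducible)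
  have hKunr := ShimuraKolyvaginOfImage.isUnramifiedIn_rat_of_not_dvd_discr K hp (hin p hpS).2.2.2.2
  have hWp := WeierstrassCurve.exists_weilPairing_holds W p
  have hA : ∀ (n : ℕ) (d : KolyvaginFamilyData W K ι n), d.y = ys n → Squarefree n →
      (∀ q' ∈ n.primeFactors, IsKolyvaginPrime (W.conductorNorm ℤ) W K p q') →
      ∀ j : ℕ, IsAdmissible (absoluteGaloisGroup K) d.pointsSubgroup ((p ^ j : ℕ) : ℤ) :=
    fun n d _ hn hKP j ↦ d.isAdmissible_pointsSubgroup_family_of_hasIrreducibleModPGaloisRep hK hn.ne_zero hp hp2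
      hirr hWp hKunr (fun hpn ↦ (hKP p (Nat.mem_primeFactors.mpr ⟨hp, hpn, hn.ne_zero⟩)).2.2.2.1 rfl) j
  -- invariance of `[P_n]` mod `p^j`, `1 ≤ j ≤ M(n)`, for every datum (tam3-p1's p604825, from (B4) of `LabelsAt`)
  have hP := Koly.familyInvariance_of_labelsAt W hK ι hp Dt ys hL
  -- the Gross level index from `Frob = Frob_∞` on `K(E[p^j])` at every prime of `n`
  have hidx : ∀ {n : ℕ} (j : ℕ), (∀ q ∈ n.primeFactors, IsKolyvaginPrime (W.conductorNorm ℤ) W K p q ∧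
      FrobEqFrobInfty W K (p ^ j) q) → ((j : ℕ) : ℕ∞) ≤ frobLevelIndex W K p n :=
    fun j hKol ↦ (natCast_le_frobLevelIndex_iff (fun q hq ↦ (hKol q hq).1) j).mpr fun q hq ↦ (hKol q hq).2
  -- the (P1) swap layer with the dictionary discharged
  refine Swap.shimuraWalk_swapSupplyAt_of_family W hPT hK hD3 hD4 p hp2 ι Dt ys hbot ?_ hceb ?_ ?_ hL.1 ?_ ?_ ?_
  · -- `hB4` read off (B4) of `LabelsAt`
    intro k hk hKP ℓ hℓ σ hσ
    have hle : ringClassField K ι (k / ℓ) ≤ ringClassField K ι k :=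
      ringClassField_mono hK ι (Nat.div_dvd_of_dvd (Nat.dvd_of_mem_primeFactors hℓ)) hk.ne_zero
    exact ⟨_, hL.2.2.2.2.1 k hk (fun q' hq' ↦ ⟨(hKP q' hq').2.1, (hKP q' hq').2.2.2.2.1⟩) ℓ hℓ hle σ hσ⟩
  · -- `hA`
    intro u m dm hdy hm hKol
    exact hA m dm hdy hm (fun q hq ↦ (hKol q hq).1) (1 + u)
  · -- `hP`
    intro u m dm hdy hm hKol
    have hKol' : ∀ q ∈ m.primeFactors, IsKolyvaginPrime (W.conductorNorm ℤ) W K p q ∧ FrobEqFrobInfty W K (p ^ (1 + u)) q :=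
      fun q hq ↦ ⟨(hKol q hq).1, by rw [Nat.add_comm]; exact (hKol q hq).2⟩
    exact hP m dm hdy hm (fun q hq ↦ (hKol q hq).1) (1 + u) (Nat.le_add_right 1 u) (hidx (1 + u) hKol')
  · -- `hsign`: Gross 5.4 in CLASS form at level `p^{1+u}` (point-level sign p605208 ⟹ class, root `Q := P_m`, `u := 0`)
    intro τ hτ u m dm hdy hm hKol
    have hKP : ∀ q ∈ m.primeFactors, IsKolyvaginPrime (W.conductorNorm ℤ) W K p q := fun q hq ↦ (hKol q hq).1
    have hKol' : ∀ q ∈ m.primeFactors, IsKolyvaginPrime (W.conductorNorm ℤ) W K p q ∧ FrobEqFrobInfty W K (p ^ (1 + u)) q :=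
      fun q hq ↦ ⟨hKP q hq, by rw [Nat.add_comm]; exact (hKol q hq).2⟩
    have hA' : IsAdmissible (absoluteGaloisGroup K) dm.pointsSubgroup ((p ^ (1 + u) : ℕ) : ℤ) := hA m dm hdy hm hKP (1 + u)
    have hP' : dm.toGeomPoints dm.derivedPoint ∈ invPoints (absoluteGaloisGroup K) dm.pointsSubgroup ((p ^ (1 + u) : ℕ) : ℤ) :=
      hP m dm hdy hm hKP (1 + u) (Nat.le_add_right 1 u) (hidx (1 + u) hKol')
    have hcong := pointsMap_derivedPoint_familyData_of_labelsAt hK ι Dt hp ys hL hA hτ (isLiftOfAut_liftAut τ) m dm hdy hm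
      hKP (1 + u) (Nat.le_add_right 1 u) (hidx (1 + u) hKol')
    rw [dm.kolyvaginClass_eq_cocycleClass (Fact.out : p.Prime) (1 + u) hA' hP']
    exact Koly.conjAct_kolyvaginClass_root_eq_smul_family dm hp (k := 1 + u) (u := 0) hA' (isLiftOfAut_liftAut τ)
      (dm.pointsMap_mem_pointsSubgroup_family hK hm.ne_zero (isLiftOfAut_liftAut τ)) _ hcong dm.derivedPoint
      (by rw [pow_zero, Nat.cast_one, one_smul]) hA' hP'
  · -- `hsel`: the level-`p` root classes lie in `H_{𝓕(m)}` for the global intrinsic transverse family (the vocabulary bridge)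
    intro 𝒯 h𝒯 u m dm hdy hm hKol Q hA1 hQ hQP
    have hKP : ∀ q ∈ m.primeFactors, IsKolyvaginPrime (W.conductorNorm ℤ) W K p q := fun q hq ↦ (hKol q hq).1
    have huk : ((u + 1 : ℕ) : ℕ∞) ≤ frobLevelIndex W K p m := hidx (u + 1) hKol
    refine (mem_selmerGroup_selmerF_iff W _ 𝒯 hm.ne_zero _).mpr ⟨?_, ?_⟩
    · exact Koly.familyRootKummer_of_selmerLocalKer W hK ι p ys hA hP hSel 1 m dm le_rfl hdy hm
        (fun q hq ↦ ⟨hKP q hq, (hKol q hq).2.of_dvd (pow_dvd_pow p (Nat.le_add_left 1 u))⟩) u Q hA1 hQ hQP huk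
    · exact (globalTransverse_mem_iff h𝒯 hm _).mpr fun ℓ hℓ ↦
        rootClass_familyData_mem_transverseKer W hK hD hp2 ι 1 hm hKP dm u Q hA1 hQ hQP huk hℓ
  · -- `h44`: McCallum Prop. 4.4 for ANY two presentations at `m ∣ mℓ`, order form, level `p^{1+u}` (lane B g8 p605268)
    intro u m l hml hl hlm hKol dm dml hdy hdly v hv
    have hm : Squarefree m := hml.squarefree_of_dvd (dvd_mul_right m l)
    have hKol' : ∀ q ∈ (m * l).primeFactors, IsKolyvaginPrime (W.conductorNorm ℤ) W K p q ∧
        FrobEqFrobInfty W K (p ^ (1 + u)) q :=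
      fun q hq ↦ ⟨(hKol q hq).1, by rw [Nat.add_comm]; exact (hKol q hq).2⟩
    exact addOrderOf_localization_kolyvaginClass_familyData_eq_of_labels_of_admissible hK hD ι rfl hp2 Dt ys hL hA
      (1 + u) m (m * l) dm dml l (Nat.le_add_right 1 u) hdy hdly hm hKol' hl hlm rfl v hv

end Summit.BirchSwinnertonDyer.BirchSwinnertonDyer.Theorems.ShimuraWalk

/-! ### §2 PORT TARGET 2 (`LevelSupplyAt` at a carrier `q ∉ S`) generic in the two producers -/

namespace Summit.BirchSwinnertonDyer.Rank1Residual.X11b.Three.Koly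

open WeierstrassCurve IsDedekindDomain NumberField Field Function Literature.NumberTheory.EllipticCurves
  Literature.NumberTheory.EllipticCurves.ModularForms Literature.NumberTheory.EllipticCurves.Jetchev2008
  Literature.NumberTheory.EllipticCurves.KolyvaginCocycle
  Literature.NumberTheory.EllipticCurves.Rank1Residual Literature.NumberTheory.GaloisRepresentations
  Literature.NumberTheory.GaloisCohomology Literature.NumberTheory.Automorphic
  Literature.NumberTheory.EllipticCurves.KolyvaginEuler
  Summit.BirchSwinnertonDyer.Rank1Residual.JET Summit.BirchSwinnertonDyer.Rank1Residual.JET.SelmerVocabulary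
  Summit.BirchSwinnertonDyer.Rank1Residual.JET.Walk Summit.BirchSwinnertonDyer.Rank1Residual.JET.GlobalDuality
  Summit.BirchSwinnertonDyer.BirchSwinnertonDyer.Theorems
  Literature.NumberTheory.EllipticCurves.ShimuraCMFamily
open Summit.BirchSwinnertonDyer.BirchSwinnertonDyer.Theorems.ShimuraWalk (frobLevelIndex natCast_le_frobLevelIndex_iff
  LevelSupplyAt LabelsAt)

set_option maxHeartbeats 800000 in
/-- **PORT TARGET 2 at any odd `p ∈ S`, image-keyed, GENERIC IN THE TWO PRODUCERS** — `ShimuraWalk.LevelSupplyAt hK ι W N p ys (ord_p c_q)` at every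
`q ∉ S` from `hPT`, `LabelsAt`, the four mod-`p` image inputs over `K`, a GIVEN Kummer producer `hSel` (Gross 6.2 (1)) and a GIVEN stringent producer
`hstrqT` (Jetchev 4.9 at the bad places over each carrier `q' ∉ S` with `p ∣ c_{q'}`): lane B g10's `shimuraLevelSupplyAt_of_poitouTate_ofImage_of_carrierLabels`
VERBATIM with the two (B6)-fed producers turned into binders. CONDITIONAL; nothing booked. [cite: Jetchev2008, Thm. 1.4, Thm. 6.3, Prop. 6.4, Prop. 4.9]
[cite: GrossLMS1991, Prop. 5.4, §6 Prop. 6.2 (1)] [cite: McCallumLMS1991, §3 Cor. 3.2, §4 Prop. 4.4] [cite: CasselsFrohlichANT1967, Ch. VII Prop. 1.2 (ii)] -/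
theorem shimuraLevelSupplyAt_of_poitouTate_ofImage_of_producers
    (hPT : ∀ (K : Type) [Field K] [NumberField K], poitouTate_selmerStructure_duality_conj K)
    (W : WeierstrassCurve ℚ) [W.IsElliptic] [W.IsGloballyMinimal] (N : ℕ) [NeZero N]
    (K : Type) [Field K] [NumberField K] (S : Finset ℕ) (Dt : ModularParametrizationData W N)
    (hN : W.conductorNorm ℤ = N) {p : ℕ} [Fact p.Prime] (hp2 : p ≠ 2) (hirr : W.HasIrreducibleModPGaloisRep p)
    (hK : IsImaginaryQuadratic K) (hD : NumberField.discr K < -4)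
    (hin : ∀ ℓ ∈ S, ℓ.Prime ∧ ℓ ∣ N ∧ ¬ ℓ ^ 2 ∣ N ∧
      ((Ideal.span {(ℓ : ℤ)}).primesOver (𝓞 K)).ncard = 1 ∧ ¬ (ℓ : ℤ) ∣ NumberField.discr K)
    (hsp : ∀ ℓ : ℕ, ℓ.Prime → ℓ ∣ N → ℓ ∉ S → ((Ideal.span {(ℓ : ℤ)}).primesOver (𝓞 K)).ncard = 2)
    (hpS : p ∈ S) (ι : K →+* ℂ) (y : (W.baseChange K).toAffine.Point)
    (ys : (m : ℕ) → (W.baseChange (ringClassField K ι m)).toAffine.Point) (ε : ℤ)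
    (hL : LabelsAt W N K ι y ys ε)
    -- the two single-datum producers as HYPOTHESES: Gross 6.2 (1) Kummer membership off `n`, and Jetchev 4.9 stringent membership at
    -- the bad places over every carrier `q' ∉ S` with `p ∣ c_{q'}(E/ℚ_{q'})` (suppliers: (B6) at the carriers, or the E′-labels, …)
    (hSel : ∀ (M n : ℕ) (d : KolyvaginFamilyData W K ι n), 1 ≤ M → d.y = ys n → Squarefree n →
      (∀ q' ∈ n.primeFactors, IsKolyvaginPrime N W K p q' ∧ FrobEqFrobInfty W K (p ^ M) q') →
      ∀ 𝔳 : HeightOneSpectrum (𝓞 K), (n : 𝓞 K) ∉ 𝔳.asIdeal →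
        d.kolyvaginClass (Fact.out : p.Prime) M ∈
          selmerLocalKer (W.baseChange K) (𝔳.adicCompletion K) ((p ^ M : ℕ) : ℤ))
    (hstrqT : ∀ (q' : ℕ) [Fact q'.Prime], q' ∣ N → q' ∉ S → p ∣ (W.baseChange ℚ_[q']).localTamagawaNumber ℤ_[q'] →
      ∀ (k : ℕ) (hn : ((p ^ k : ℕ) : ℤ) ≠ 0) (n : ℕ) (d : KolyvaginFamilyData W K ι n), 1 ≤ k → d.y = ys n →
      Squarefree n →
      (∀ q'' ∈ n.primeFactors, IsKolyvaginPrime N W K p q'' ∧ FrobEqFrobInfty W K (p ^ k) q'') →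
      ∀ v : HeightOneSpectrum (𝓞 K), ((q' : ℕ) : 𝓞 K) ∈ v.asIdeal → ¬ (W.baseChange K).HasGoodReductionAt v →
        galoisCohomology.localization ((W.baseChange K).torsionGaloisModule ((p ^ k : ℕ) : ℤ)) (Sum.inr v) 1
          (d.kolyvaginClass (Fact.out : p.Prime) k) ∈ stringentFamily W K hn (Sum.inr v))
    -- the four mod-`p` IMAGE INPUTS over `K` (corner-p1's `_ofImage` binders)
    (hIz : ∃ z : Field.absoluteGaloisGroup K, ∀ t : geomTorsion (W.baseChange K) p, z • t = -t)
    (hIs : (W.baseChange K).HasIrreducibleModPGaloisRep p)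
    (hIc : ∀ f : geomTorsion (W.baseChange K) p →+ geomTorsion (W.baseChange K) p,
      (∀ (g : Field.absoluteGaloisGroup K) (t : geomTorsion (W.baseChange K) p), f (g • t) = g • f t) →
        ∃ k : ℤ, ∀ t, f t = k • t)
    (hIt : AddSubgroup.torsionBy (W.baseChange K).toAffine.Point (p : ℤ) = ⊥)
    (q : ℕ) [Fact q.Prime] (hqS : q ∉ S) :
    LevelSupplyAt hK ι W N p ys (padicValNat p ((W.baseChange ℚ_[q]).localTamagawaNumber ℤ_[q])) := by
  subst hN
  haveI hRCF : ∀ j : ℕ, NumberField (ringClassField K ι j) := numberField_ringClassField K hK ι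
  have hp : p.Prime := Fact.out
  -- the trivial case `t = 0`
  rcases Nat.eq_zero_or_pos (padicValNat p ((W.baseChange ℚ_[q]).localTamagawaNumber ℤ_[q])) with ht0 | htpos
  · rw [ht0]
    intro k c _ _ _
    simp
  set t : ℕ := padicValNat p ((W.baseChange ℚ_[q]).localTamagawaNumber ℤ_[q]) with ht
  -- `p ∣ c_q`, so `q` is a bad prime: `q ∣ N`, and (as `q ∉ S`) it splits in `K`
  obtain ⟨vq, hqq⟩ : ∃ v : HeightOneSpectrum (𝓞 ℚ), (Rat.HeightOneSpectrum.primesEquiv v : ℕ) = q :=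
    ⟨Rat.HeightOneSpectrum.primesEquiv.symm ⟨q, Fact.out⟩, by rw [Equiv.apply_symm_apply]⟩
  have hcq : (W.baseChange ℚ_[q]).localTamagawaNumber ℤ_[q] = W.tamagawaNumberAt vq :=
    WeierstrassCurve.localTamagawaNumber_padic_eq_holds W vq q hqq
  have hbad : ¬ W.HasGoodReductionAt vq := fun hgood ↦ by
    have h1 : W.tamagawaNumberAt vq = 1 :=
      WeierstrassCurve.localTamagawaNumber_eq_one_of_hasGoodReductionAt_holds W vq hgood
    have : t = 0 := by rw [ht, hcq, h1, padicValNat_one_right]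
    omega
  have hqN : q ∣ W.conductorNorm ℤ := by rw [← hqq]; exact (W.dvd_conductorNorm_iff vq).mpr hbad
  have hq2 := hsp q Fact.out hqN hqS
  -- complex conjugation and the carrier place `v₀ ∋ q` moved by it
  have hc1 : (W.baseChange ℚ_[q]).localTamagawaNumber ℤ_[q] ≠ 1 := fun h1 ↦ by
    have : t = 0 := by rw [ht, h1, padicValNat_one_right]
    omega
  haveI : Algebra.IsQuadraticExtension ℚ K := ⟨hK.1⟩
  have hcardG : Nat.card (K ≃ₐ[ℚ] K) = 2 := by rw [IsGalois.card_aut_eq_finrank, hK.1]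
  obtain ⟨τ, hτ, huniq⟩ := (Nat.card_eq_two_iff' (1 : K ≃ₐ[ℚ] K)).mp hcardG
  have hτ2 : τ * τ = 1 := by
    rw [mul_eq_one_iff_eq_inv]
    exact (huniq τ⁻¹ (inv_ne_one.mpr hτ)).symm
  obtain ⟨v₀, hv₀, hv₀N, hqv₀⟩ := ShimuraWalk.exists_split_place_of_ncard_eq_two K hK τ hτ q hq2 hqN
  -- every place `v ∋ q` of `K` is moved by `τ` and is BAD for `E/K` (`c_v = c_q ≠ 1`; CF VII 1.2 (ii))
  have hbadK : ∀ v : HeightOneSpectrum (𝓞 K), ((q : ℕ) : 𝓞 K) ∈ v.asIdeal →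
      ¬ (W.baseChange K).HasGoodReductionAt v := by
    intro v hqv hgood
    obtain ⟨σ, hσ⟩ := HeightOneSpectrum.exists_algEquiv_smul_eq (F := ℚ) (w := v₀) (w' := v)
      (LocalField.heightOneSpectrum_rat_eq_of_natCast_mem q _ _
        (LocalField.natCast_mem_under q v₀ hqv₀) (LocalField.natCast_mem_under q v hqv))
    have hτv : τ • v ≠ v := by
      by_cases hσ1 : σ = 1
      · subst hσ1
        rw [one_smul] at hσ
        subst hσ
        exact hv₀
      · have hστ : σ = τ := huniq σ hσ1
        subst hστ
        subst hσ
        rw [smul_smul, hτ2, one_smul]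
        exact fun h ↦ hv₀ h.symm
    obtain ⟨-, -, hcEq', -, -⟩ := carrierRowData_of_split W K q hK τ v hτv hqv
    exact hc1 (hcEq'.symm.trans
      ((W.baseChange K).localTamagawaNumber_eq_one_of_hasGoodReductionAt_holds v hgood))
  have hqv₀' : ((q : ℕ) : 𝓞 K) ∈ (τ • v₀).asIdeal := by
    have := (HeightOneSpectrum.smul_mem_smul_asIdeal_iff τ v₀ ((q : ℕ) : 𝓞 K)).mpr hqv₀
    rwa [GlobalDuality.smul_natCast_ringOfIntegers] at this
  have hv₀N' : ((W.conductorNorm ℤ : ℕ) : 𝓞 K) ∈ (τ • v₀).asIdeal := by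
    have := (HeightOneSpectrum.smul_mem_smul_asIdeal_iff τ v₀ ((W.conductorNorm ℤ : ℕ) : 𝓞 K)).mpr hv₀N
    rwa [GlobalDuality.smul_natCast_ringOfIntegers] at this
  -- the (δ) row data at `v₀` (Kodaira–Néron cyclicity transported from `ℚ_q`)
  obtain ⟨hminK, hminP, hcEq, hc0, hcyc⟩ := carrierRowData_of_split W K q hK τ v₀ hv₀ hqv₀
  haveI := hminK
  haveI := hminP
  have hpc : p ∣ (W.baseChange ℚ_[q]).localTamagawaNumber ℤ_[q] := dvd_of_one_le_padicValNat htpos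
  haveI := hcyc (kodairaNeron_isAddCyclic_forall W q p hp2 hpc)
  have hfac : (((W.baseChange K).baseChange (v₀.adicCompletion K)).localTamagawaNumber
      (v₀.adicCompletionIntegers K)).factorization p = t := by
    rw [hcEq, ht, Nat.factorization_def _ hp]
  -- the mod-`p` image inputs are HYPOTHESES here (`hIz`, `hIs`, `hIc`, `hIt`)
  -- `p` is unramified in `K` (`p ∈ S`), the Weil pairing
  have hKunr := ShimuraKolyvaginOfImage.isUnramifiedIn_rat_of_not_dvd_discr K hp (hin p hpS).2.2.2.2
  have hW3 := WeierstrassCurve.exists_weilPairing_holds W p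
  -- admissibility for every datum of the family (`E[p]` irreducible; the levels are prime to `p`)
  have hA : ∀ (n : ℕ) (d : KolyvaginFamilyData W K ι n), d.y = ys n → Squarefree n →
      (∀ q' ∈ n.primeFactors, IsKolyvaginPrime (W.conductorNorm ℤ) W K p q') →
      ∀ j : ℕ, IsAdmissible (absoluteGaloisGroup K) d.pointsSubgroup ((p ^ j : ℕ) : ℤ) :=
    fun n d _ hn hKP j ↦ d.isAdmissible_pointsSubgroup_family_of_hasIrreducibleModPGaloisRep hK hn.ne_zero hp hp2
      hirr hW3 hKunr (fun hpn ↦ (hKP p (Nat.mem_primeFactors.mpr ⟨hp, hpn, hn.ne_zero⟩)).2.2.2.1 rfl) j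
  -- invariance of `[P_n]` mod `p^j`, `j ≤ M(n)`, for every datum (tam3-p1's p604825, from (B4) of `LabelsAt`)
  have hP := familyInvariance_of_labelsAt W hK ι hp Dt ys hL
  -- producers: `hsign` p605208, `h47` p605268 (lane B g8); `hSel` is a hypothesis; `hstrq` from the hypothesis `hstrqT` at `q`
  have hsign : ∀ (c : K ≃ₐ[ℚ] K), c ≠ 1 → ∀ (n : ℕ) (d : KolyvaginFamilyData W K ι n), d.y = ys n → Squarefree n →
      (∀ q' ∈ n.primeFactors, IsKolyvaginPrime (W.conductorNorm ℤ) W K p q') →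
      ∀ j : ℕ, 1 ≤ j → (j : ℕ∞) ≤ frobLevelIndex W K p n →
      ∃ B ∈ d.pointsSubgroup, (isLiftOfAut_liftAut c).pointsMap W (d.toGeomPoints d.derivedPoint) =
        (ε * (-1) ^ n.primeFactors.card) • d.toGeomPoints d.derivedPoint + ((p ^ j : ℕ) : ℤ) • B :=
    fun c hc n d hdy hn hKol j hj hjM ↦
      ShimuraWalk.pointsMap_derivedPoint_familyData_of_labelsAt hK ι Dt hp ys hL hA hc (isLiftOfAut_liftAut c) n d hdy hn
        hKol j hj hjM
  have hstrq : ∀ (k : ℕ) (hn : ((p ^ k : ℕ) : ℤ) ≠ 0) (n : ℕ) (d : KolyvaginFamilyData W K ι n), 1 ≤ k → d.y = ys n →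
      Squarefree n →
      (∀ q' ∈ n.primeFactors, IsKolyvaginPrime (W.conductorNorm ℤ) W K p q' ∧ FrobEqFrobInfty W K (p ^ k) q') →
      n.primeFactors.Nonempty →
      ∀ v : HeightOneSpectrum (𝓞 K), ((q : ℕ) : 𝓞 K) ∈ v.asIdeal →
        galoisCohomology.localization ((W.baseChange K).torsionGaloisModule ((p ^ k : ℕ) : ℤ)) (Sum.inr v) 1
          (d.kolyvaginClass (Fact.out : p.Prime) k) ∈ stringentFamily W K hn (Sum.inr v) :=
    fun k hn' n d hk hdy hn hKol _ v hqv ↦ hstrqT q hqN hqS hpc k hn' n d hk hdy hn hKol v hqv (hbadK v hqv)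
  have h47 : ∀ (k n n' : ℕ) (d : KolyvaginFamilyData W K ι n) (d' : KolyvaginFamilyData W K ι n') (ℓ : ℕ),
      1 ≤ k → d.y = ys n → d'.y = ys n' → Squarefree n →
      (∀ q' ∈ n'.primeFactors, IsKolyvaginPrime (W.conductorNorm ℤ) W K p q' ∧ FrobEqFrobInfty W K (p ^ k) q') →
      ℓ.Prime → ¬ ℓ ∣ n → n' = n * ℓ →
      ∀ v : HeightOneSpectrum (𝓞 K), (ℓ : 𝓞 K) ∈ v.asIdeal →
      addOrderOf (galoisCohomology.localization ((W.baseChange K).torsionGaloisModule ((p ^ k : ℕ) : ℤ))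
          (Sum.inr v) 1 (d'.kolyvaginClass (Fact.out : p.Prime) k)) =
        addOrderOf (galoisCohomology.localization ((W.baseChange K).torsionGaloisModule ((p ^ k : ℕ) : ℤ))
          (Sum.inr v) 1 (d.kolyvaginClass (Fact.out : p.Prime) k)) :=
    fun k n n' d d' ℓ hk hdy hd'y hn hKol hℓ hℓn hn' v hv ↦
      ShimuraWalk.addOrderOf_localization_kolyvaginClass_familyData_eq_of_labels_of_admissible hK hD ι rfl hp2 Dt ys hL hA
        k n n' d d' ℓ hk hdy hd'y hn hKol hℓ hℓn hn' v hv
  -- the END GLUE over the (P2) assembly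
  refine ShimuraWalk.levelSupplyAt_of_familyLevelSupplyGross hK ι Dt hp ys t ?_ ?_
  · -- `hB4` read off (B4) of `LabelsAt`
    intro k hk hKP ℓ hℓ σ hσ
    have hle : ringClassField K ι (k / ℓ) ≤ ringClassField K ι k :=
      ringClassField_mono hK ι (Nat.div_dvd_of_dvd (Nat.dvd_of_mem_primeFactors hℓ)) hk.ne_zero
    exact ⟨_, hL.2.2.2.2.1 k hk (fun q' hq' ↦ ⟨(hKP q' hq').2.1, (hKP q' hq').2.2.2.2.1⟩) ℓ hℓ hle σ hσ⟩
  · refine familyLevelSupply_of_memberships W K hK hD ι p hp2 τ hτ hPT ys ε hL.1 t v₀ hv₀ hv₀N hv₀N'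
      ?_ ?_ hA hP ?_ (hsign τ hτ) ?_ ?_ ?_ h47
    · -- the carrier's (δ) data at every level `p^k ≥ p^t`
      intro _ k hn htk
      refine ⟨fun w ↦ stringentFamily_le_kummer W K hn w,
        fun v' w h _ x hx ↦ conjActPlace_mem_stringentFamily W τ hn h hx,
        isAddCyclic_kummer_quotient_stringentFamily W K hn v₀, ?_⟩
      rw [← hfac]
      exact relIndex_stringentFamily_eq_pow W K hp k hn v₀ hc0 (by rw [hfac]; exact htk)
    · -- Čebotarev at level `p^k` from the mod-`p` image inputs (corner-p1's `_ofImage`)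
      intro k hk j e he x y' hx hy hy0 b
      obtain ⟨ℓ, hbℓ, ⟨hKol, hfrob⟩, hord⟩ :=
        exists_grossKolyvaginPrime_addOrderOf_localization_eq_shift_ofImage W (N := W.conductorNorm ℤ) hK hp2
          hIz hIs hIc hIt τ hτ hk j he x y' hx hy hy0 b
      exact ⟨ℓ, hbℓ, hKol, hfrob, hord⟩
    · -- `τ̃`-stability of `E(K[n]) ⊆ E(K̄)`
      intro n d _ hn
      exact d.pointsMap_mem_pointsSubgroup_family hK hn.ne_zero (isLiftOfAut_liftAut τ)
    · -- Kummer membership of the root classes off `n`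
      exact familyRootKummer_of_selmerLocalKer W hK ι p ys hA hP hSel
    · -- transverse condition of the root classes at the primes of `n`
      intro k n d _ _ hn hG u Q hAk hQ hQP huk ℓ hℓ
      exact ShimuraWalk.rootClass_familyData_mem_transverseKer W hK hD hp2 ι k hn (fun q' hq' ↦ (hG q' hq').1) d u Q
        hAk hQ hQP huk hℓ
    · -- stringent membership at the two carrier places (both lie over `q`)
      intro k hn' n d hk hy hsq hG hne q₀ hq₀
      refine hstrq k hn' n d hk hy hsq hG hne q₀ ?_
      simp only [Finset.mem_insert, Finset.mem_singleton] at hq₀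
      rcases hq₀ with rfl | rfl
      exacts [hqv₀, hqv₀']

end Summit.BirchSwinnertonDyer.Rank1Residual.X11b.Three.Koly

end
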